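import Literature.Probability.RandomPlanarGeometry.HexParafermionProofs
import HarnessLib

/-!
# Boundary exactness of the SAW developing map, I: explicit walks, turn counts, floor walks

Route `SAWDefectDecoherence`, crux `BoundaryClosureR` (stmt-CriticalPhenomena-14004), line
`pick-half-plane`, support for the stub `stub_boundaryExactness` (clauses (E3) straight gate and
(E4) root arms of the exact boundary data of the developing map).  Finite honeycomb bookkeeping:

* `exists_mkWalk` — an explicit duplicate-free chain of `Λ` between a boundary root `{u, v₁}` and a
  dangling edge `{e, vₙ}` (`u, e ∉ Λ`) is a self-avoiding walk between these mid-edges;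
* `winding_eq_pturn_toHV` — its winding is `(π/3) · pturn` of the code `toHV (u :: verts ++ [e])`
  (the embedded honeycomb is the coordinate model `HV` scaled by `1/3`, lattice turns are `±π/3`);
* `exists_zig` — the zigzag row `(k,m,0), (k,m,1), (k+1,m,0), …, (k+n,m,0)` of a flat floor and
  its turn counts; `exists_extend` — rerouting a walk after a vertex, the winding split there;
* `exists_floor_walks` / `boundaryExactness_floorWalks` — between two floor edges of a flat
  floor there are explicit walks of winding `-π` eastwards and `+π` westwards.
Turns are counted in the coordinate model `HV` of `HexSAWWinding`; no definition is introduced.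
-/

noncomputable section

open Literature.Probability.LatticeModels Literature.Probability.RandomPlanarGeometry.SAW
open Literature.Probability.RandomPlanarGeometry.SAW.HV

namespace Summit.CriticalPhenomena.SAWScalingLimit.Theorems.PickHalfPlane.BoundaryExactness

variable {Λ : Finset HexVertex}

/-! ### Walks from explicit vertex lists -/

/-- **A walk from an explicit vertex list**: a nonempty duplicate-free chain `L` of `Λ`, entered
from `u ∉ Λ` through the root `a = {u, L.head}` and left through the dangling edge
`z = {e, L.last}` (`e ∉ Λ`, `z ≠ a`), is the vertex list of a self-avoiding walk `a → z` (the
inner edges join vertices of `Λ`, while `a ≠ z` contain a vertex off `Λ`). [folklore] -/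
theorem exists_mkWalk (a z : Sym2 HexVertex) (u : HexVertex) (L : List HexVertex) (e : HexVertex)
    (hL : L ≠ []) (ha : a = s(u, L.head hL)) (hz : z = s(e, L.getLast hL))
    (hsub : ∀ v ∈ L, v ∈ Λ) (hnd : L.Nodup) (hch : L.IsChain hexGraph.Adj)
    (hu : u ∉ Λ) (hua : hexGraph.Adj u (L.head hL)) (he : e ∉ Λ) (haz : a ≠ z) :
    ∃ γ : HexMidEdgeSAW Λ a z, γ.verts = L := by
  refine ⟨⟨L, hsub, hnd, hch, fun v hv => ?_, fun v hv => ?_, fun h => absurd h hL, fun _ => ?_,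
    ⟨by rw [ha]; exact (SimpleGraph.mem_edgeSet hexGraph).2 hua, L.head hL,
      by rw [ha]; exact Sym2.mem_mk_right _ _, hsub _ (List.head_mem hL)⟩⟩, rfl⟩
  · rw [List.head?_eq_some_head hL, Option.some_inj] at hv
    rw [ha, ← hv]
    exact Sym2.mem_mk_right _ _
  · rw [List.getLast?_eq_some_getLast hL, Option.some_inj] at hv
    rw [hz, ← hv]
    exact Sym2.mem_mk_right _ _
  · refine List.nodup_append.2 ⟨List.nodup_cons.2 ⟨fun h => hu ?_, edges_nodup hnd⟩,
      List.nodup_singleton _, fun x hx y hy => ?_⟩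
    · exact hsub u (forall_mem_of_mem_edges L a h u (by rw [ha]; exact Sym2.mem_mk_left _ _))
    · rw [List.mem_singleton] at hy
      subst hy
      rcases List.mem_cons.1 hx with rfl | hx
      · exact haz
      · rintro rfl
        exact he (hsub e (forall_mem_of_mem_edges L _ hx e (by rw [hz]; exact Sym2.mem_mk_left _ _)))

/-! ### The winding as a turn count in the coordinate model -/

/-- **The winding of a walk from a boundary root `{u, w₁}` (`u ∉ Λ`) to a dangling edge whose far
end `e` lies off `Λ` is `(π/3) · pturn` of the coordinate code of `u :: verts ++ [e]`**: the end
half-edges do not turn (`HexMidEdgeSAW.winding_eq_winding_map`), the embedded honeycomb is the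
coordinate model scaled by `1/3` (`HV.emb_pos_toHV`), and an embedded lattice path without
backtracking turns by `(π/3) · pturn` (`HV.winding_map_emb_pos`). [folklore] -/
theorem winding_eq_pturn_toHV {a : Sym2 HexVertex} {u w₁ v t : HexVertex}
    (γ : HexMidEdgeSAW Λ a s(v, t)) (ha : a = s(u, w₁)) (hu : u ∉ Λ) (huw : hexGraph.Adj u w₁)
    (hvt : hexGraph.Adj v t) (hne : γ.verts ≠ []) {e : HexVertex}
    (he : (γ.verts.getLast hne = v ∧ e = t) ∨ (γ.verts.getLast hne = t ∧ e = v)) (heΛ : e ∉ Λ) :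
    γ.winding = (Real.pi / 3) * pturn ((u :: (γ.verts ++ [e])).map toHV) := by
  rw [γ.winding_eq_winding_map ha hu hne he]
  have e1 : (u :: (γ.verts ++ [e])).map hexCenter =
      ((((u :: (γ.verts ++ [e])).map toHV).map fun y => emb (pos y)).map
        fun z => (3 : ℂ)⁻¹ * z + 0) := by
    simp only [List.map_map]
    refine List.map_congr_left fun f _ => ?_
    simp only [Function.comp_apply, emb_pos_toHV]
    ring
  rw [e1, winding_map_affine (inv_ne_zero three_ne_zero)]
  refine winding_map_emb_pos _ ?_ ?_
  · rw [List.isChain_map]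
    refine List.IsChain.imp (fun x y h => (hexGraph_adj_iff_hvGraph_adj x y).1 h) ?_
    refine List.isChain_cons.2 ⟨fun y hy => ?_, List.isChain_append.2 ⟨γ.isChain,
      List.isChain_singleton _, fun x hx y hy => ?_⟩⟩
    · have h1 : (γ.verts ++ [e]).head? = some (γ.verts.head hne) := by
        rw [List.head?_eq_some_head (by simp [hne] : γ.verts ++ [e] ≠ []), List.head_append_of_ne_nil]
      rw [h1, Option.mem_def, Option.some_inj] at hy
      rw [← hy, γ.head_eq ha hu hne]
      exact huw
    · rw [List.getLast?_eq_some_getLast hne, Option.mem_def, Option.some_inj] at hx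
      simp only [List.head?_cons, Option.mem_def, Option.some_inj] at hy
      subst hx; subst hy
      rcases he with ⟨h1, rfl⟩ | ⟨h1, rfl⟩
      · rw [h1]; exact hvt
      · rw [h1]; exact hvt.symm
  · -- no backtracking: `verts ++ [e]` has no repeated vertex, and `u` is not two steps ahead
    have hnd : ((γ.verts ++ [e]).map toHV).Nodup := by
      refine List.Nodup.map hvEquiv.injective (List.nodup_append.2
        ⟨γ.nodup, List.nodup_singleton _, fun x hx y hy => ?_⟩)
      rw [List.mem_singleton] at hy
      subst hy
      rintro rfl
      exact heΛ (γ.subset _ hx)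
    intro i hi h
    rcases i with _ | i
    · simp only [List.map_cons, List.getElem_cons_zero, List.getElem_cons_succ] at h
      have hmem : ((γ.verts ++ [e]).map toHV)[1]'(by simp at hi ⊢; omega) ∈
          (γ.verts ++ [e]).map toHV := List.getElem_mem _
      rw [← h, List.mem_map] at hmem
      obtain ⟨y, hy, hyu⟩ := hmem
      have hyu' : y = u := hvEquiv.injective hyu
      rcases List.mem_append.1 hy with hy' | hy'
      · exact hu (hyu' ▸ γ.subset y hy')
      · have hue : u = e := hyu'.symm.trans (List.mem_singleton.1 hy')
        -- `u = e`: then `e` sits at index `1`, the walk visits one vertex, and `a = z`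
        have h2 : ((γ.verts ++ [e]).map toHV)[1]'(by simp at hi ⊢; omega) =
            ((γ.verts ++ [e]).map toHV)[γ.verts.length]'(by simp) := by
          rw [← h, hue]
          simp [List.getElem_append_right]
        have hlen : γ.verts.length = 1 := ((hnd.getElem_inj_iff).1 h2).symm
        obtain ⟨x, r, hx⟩ := List.exists_cons_of_ne_nil hne
        have hr : r = [] := by simpa [hx] using hlen
        subst hr
        have hxw : x = w₁ := by have := γ.head_eq ha hu hne; simpa [hx] using this
        have hlast : γ.verts.getLast hne = x := by simp [hx]
        have hed := γ.edges_nodup hne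
        rw [hx] at hed
        have haz : a ≠ s(v, t) := by simpa using hed
        apply haz
        rw [ha, hue, ← hxw]
        rw [hlast] at he
        rcases he with ⟨h1, h2⟩ | ⟨h1, h2⟩
        · rw [← h2, h1, Sym2.eq_swap]
        · rw [← h2, h1]
    · simp only [List.map_cons, List.getElem_cons_succ] at h
      have := (hnd.getElem_inj_iff).1 h
      omega

/-! ### Coordinates -/

/-- A vertex of `ℍ` from its three coordinates. [folklore] -/
theorem eq_mk_of_coord {p : HexVertex} {c d : ℤ} {i : Fin 2} (h0 : p.1 0 = c) (h1 : p.1 1 = d)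
    (h2 : p.2 = i) : p = (![c, d], i) := by
  obtain ⟨x, i'⟩ := p
  simp only at h0 h1 h2
  subst h2
  refine Prod.ext ?_ rfl
  exact (site_two_eq_iff _ _).2 ⟨by simp [h0], by simp [h1]⟩

/-- The coordinate code of a vertex from its three coordinates. [folklore] -/
theorem toHV_of_coord {p : HexVertex} {c d : ℤ} {i : Fin 2} (h0 : p.1 0 = c) (h1 : p.1 1 = d)
    (h2 : p.2 = i) : toHV p = (c, d, decide (i = 1)) := by
  rw [eq_mk_of_coord h0 h1 h2]; rfl

/-- Equality of vertices of `ℍ` in coordinates. [folklore] -/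
theorem mk_eq_mk_iff {c d c' d' : ℤ} {i l : Fin 2} :
    ((![c, d], i) : HexVertex) = (![c', d'], l) ↔ (c = c' ∧ d = d') ∧ i = l := by
  rw [Prod.mk.injEq, site_two_eq_iff]
  simp

/-- The code of an up face. [folklore] -/
@[simp] theorem toHV_up (c d : ℤ) : toHV ((![c, d], 0) : HexVertex) = (c, d, false) := rfl

/-- The code of a down face. [folklore] -/
@[simp] theorem toHV_down (c d : ℤ) : toHV ((![c, d], 1) : HexVertex) = (c, d, true) := rfl

/-! ### Turns along a flat floor (from the twelve turns of `HexSAWWinding`) -/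

/-- `(k,m,1) → (k+1,m,0) → below`: a right turn. [folklore] -/
@[simp] theorem turn_MUB (k m : ℤ) :
    turn (k, m, true) (k + 1, m, false) (k + 1, m - 1, true) = -1 := by
  simpa only [add_sub_cancel_right] using turn_f12 (k + 1) m

/-- `(k+1,m,1) → (k+1,m,0) → (k,m,1)` (westward along the row): a right turn. [folklore] -/
@[simp] theorem turn_M1UM (k m : ℤ) :
    turn (k + 1, m, true) (k + 1, m, false) (k, m, true) = -1 := by
  simpa only [add_sub_cancel_right] using turn_f01 (k + 1) m

/-! ### The zigzag row -/

/-- **The zigzag row of a flat floor.** If the up faces `(i,m,0)`, `k < i ≤ k+n`, and the down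
faces `(i,m,1)`, `k ≤ i < k+n`, lie in `Λ`, there is `L` with `(k,m,0) :: L` the duplicate-free
chain `(k,m,0), (k,m,1), (k+1,m,0), …, (k+n,m,0)` (last vertex, no repetition, adjacency, columns,
membership recorded) and two turn counts: entered from the west (`(k-1,m,1) → (k,m,0)`) and left
downwards it turns by `-1`; entered from below (`n ≥ 1`) and left downwards, by `-3` (headings
`90°, 30°, -30°, …, -30°, -90°`: winding `-π`). [folklore] -/
theorem exists_zig (m : ℤ) : ∀ (n : ℕ) (k : ℤ),
    (∀ i : ℤ, k < i → i ≤ k + n → ((![i, m], 0) : HexVertex) ∈ Λ) →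
    (∀ i : ℤ, k ≤ i → i < k + n → ((![i, m], 1) : HexVertex) ∈ Λ) →
    ∃ L : List HexVertex,
      (((![k, m], 0) : HexVertex) :: L).getLast (List.cons_ne_nil _ _) = (![k + n, m], 0) ∧
      (((![k, m], 0) : HexVertex) :: L).Nodup ∧
      (((![k, m], 0) : HexVertex) :: L).IsChain hexGraph.Adj ∧
      (∀ v ∈ L, k < v.1 0 ∨ v = (![k, m], 1)) ∧ (∀ v ∈ L, v ∈ Λ) ∧
      pturn ((k - 1, m, true) :: (k, m, false) :: (L.map toHV ++ [(k + n, m - 1, true)])) = -1 ∧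
      (0 < n →
        pturn ((k, m - 1, true) :: (k, m, false) :: (L.map toHV ++ [(k + n, m - 1, true)])) = -3)
  | 0, k, _, _ => ⟨[], by simp, by simp, List.isChain_singleton _, by simp, by simp, by simp, by simp⟩
  | n + 1, k, hU, hM => by
    obtain ⟨L, h1, h2, h3, h4, h5, h6, -⟩ := exists_zig m n (k + 1)
      (fun i hi1 hi2 => hU i (by omega) (by push_cast; omega))
      (fun i hi1 hi2 => hM i (by omega) (by push_cast; omega))
    have e : k + 1 + (n : ℤ) = k + ((n + 1 : ℕ) : ℤ) := by push_cast; ring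
    rw [e, add_sub_cancel_right] at h6
    rw [e] at h1
    refine ⟨(![k, m], 1) :: (![k + 1, m], 0) :: L, h1, ?_, ?_, ?_, ?_, ?_, fun _ => ?_⟩
    · refine List.nodup_cons.2 ⟨?_, List.nodup_cons.2 ⟨?_, h2⟩⟩ <;>
        simp only [List.mem_cons, mk_eq_mk_iff, not_or]
      · exact ⟨by simp, by simp, fun h => absurd (h4 _ h) (by simp)⟩
      · exact ⟨by simp, fun h => absurd (h4 _ h) (by simp)⟩
    · refine List.isChain_cons_cons.2 ⟨by rw [hexGraph_adj_iff_coord]; simp, ?_⟩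
      exact List.isChain_cons_cons.2 ⟨by rw [hexGraph_adj_iff_coord]; simp, h3⟩
    · simp only [List.mem_cons]
      rintro v (rfl | rfl | hv)
      · exact Or.inr rfl
      · left; simp
      · left
        rcases h4 v hv with h | rfl
        · omega
        · simp
    · simp only [List.mem_cons]
      rintro v (rfl | rfl | hv)
      · exact hM k le_rfl (by push_cast; omega)
      · exact hU (k + 1) (by omega) (by push_cast; omega)
      · exact h5 v hv
    · simp only [List.map_cons, List.cons_append, toHV_up, toHV_down, pturn_cons₃] at h6 ⊢
      rw [h6, turn_f10, turn_t01]
      norm_num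
    · simp only [List.map_cons, List.cons_append, toHV_up, toHV_down, pturn_cons₃] at h6 ⊢
      rw [h6, turn_f20, turn_t01]
      norm_num

/-! ### Cutting a walk at its first visit to a flat floor and rerouting it -/

/-- First entry of a list into `Q` (cf. `HV.exists_first_mem_split`). [folklore] -/
theorem exists_first_mem_split' {α : Type*} [DecidableEq α] (Q : List α) :
    ∀ P : List α, (∃ x ∈ P, x ∈ Q) →
      ∃ (A : List α) (m : α) (B : List α), P = A ++ m :: B ∧ m ∈ Q ∧ ∀ x ∈ A, x ∉ Q
  | [], h => by simp at h
  | x :: P, h => by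
    by_cases hx : x ∈ Q
    · exact ⟨[], x, P, rfl, hx, by simp⟩
    · obtain ⟨A, m, B, rfl, hm, hA⟩ := exists_first_mem_split' Q P (by simpa [hx] using h)
      exact ⟨x :: A, m, B, rfl, hm, by simpa [hx] using hA⟩

/-- **Rerouting a walk after a vertex.** Let `δ` be a walk from the boundary root `{u, w}`
(`u ∉ Λ`) with vertex list `A ++ zv :: B`, and `zv :: S` a duplicate-free chain of `Λ` avoiding
`A`, ending at `t`, `e ∉ Λ` adjacent to `t`, `{e, t} ≠ {u, w}`. Then `A ++ zv :: S` is a walk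
`{u, w} → {e, t}` whose winding is `(π/3)` times (the turns of the code of `u :: A ++ [zv]`) plus
(the turns of the code of `p :: zv :: S ++ [e]`), `p` the vertex before `zv`. [folklore] -/
theorem exists_extend {u w : HexVertex} {z : Sym2 HexVertex} (hu : u ∉ Λ)
    (huw : hexGraph.Adj u w) (δ : HexMidEdgeSAW Λ s(u, w) z) {A B : List HexVertex}
    {zv : HexVertex} (hsplit : δ.verts = A ++ zv :: B) (S : List HexVertex) (e t : HexVertex)
    (hS : ∀ x ∈ zv :: S, x ∈ Λ) (hSnd : (zv :: S).Nodup) (hSch : (zv :: S).IsChain hexGraph.Adj)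
    (hAS : ∀ x ∈ A, x ∉ zv :: S) (ht : (zv :: S).getLast (List.cons_ne_nil _ _) = t)
    (he : e ∉ Λ) (het : hexGraph.Adj e t) (haz : s(u, w) ≠ s(e, t)) :
    ∃ γ : HexMidEdgeSAW Λ s(u, w) s(e, t),
      γ.winding = (Real.pi / 3) *
        (pturn ((u :: A).map toHV ++ [toHV zv]) +
          pturn (toHV ((u :: A).getLast (List.cons_ne_nil _ _)) :: toHV zv :: (S ++ [e]).map toHV)) := by
  have hne : δ.verts ≠ [] := by rw [hsplit]; simp
  have hhead : δ.verts.head hne = w := δ.head_eq rfl hu hne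
  have hL : A ++ zv :: S ≠ [] := by simp
  have hLhead : (A ++ zv :: S).head hL = w := by
    rw [← hhead]
    simp only [hsplit]
    cases A <;> rfl
  have hLlast : (A ++ zv :: S).getLast hL = t := by
    rw [List.getLast_append_of_ne_nil _ (List.cons_ne_nil _ _)]
    exact ht
  have hsub : ∀ v ∈ A ++ zv :: S, v ∈ Λ := by
    intro v hv
    rcases List.mem_append.1 hv with hv | hv
    · exact δ.subset v (by rw [hsplit]; exact List.mem_append_left _ hv)
    · exact hS v hv
  have hndAB : (A ++ zv :: B).Nodup := hsplit ▸ δ.nodup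
  have hnd : (A ++ zv :: S).Nodup :=
    List.nodup_append.2 ⟨(List.nodup_append.1 hndAB).1, hSnd,
      fun x hx y hy hxy => hAS x hx (hxy ▸ hy)⟩
  have hchAB : (A ++ zv :: B).IsChain hexGraph.Adj := hsplit ▸ δ.isChain
  have hch : (A ++ zv :: S).IsChain hexGraph.Adj := by
    obtain ⟨hA, -, hj⟩ := List.isChain_append.1 hchAB
    exact List.isChain_append.2 ⟨hA, hSch, fun x hx y hy => hj x hx y (by simpa using hy)⟩
  have hua : hexGraph.Adj u ((A ++ zv :: S).head hL) := by rw [hLhead]; exact huw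
  obtain ⟨γ, hγ⟩ := exists_mkWalk s(u, w) s(e, t) u (A ++ zv :: S) e hL
    (by rw [hLhead]) (by rw [hLlast]) hsub hnd hch hu hua he haz
  have hγlast : ∀ h, γ.verts.getLast h = t := by rw [hγ]; exact fun _ => hLlast
  refine ⟨γ, ?_⟩
  rw [winding_eq_pturn_toHV γ rfl hu huw het (by rw [hγ]; exact hL) (e := e)
    (Or.inr ⟨hγlast _, rfl⟩) he]
  congr 1
  have e1 : (u :: (γ.verts ++ [e])).map toHV =
      (u :: A).map toHV ++ toHV zv :: (S ++ [e]).map toHV := by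
    simp [hγ]
  -- split the turn sum at `zv` (as in `HV.pturn_append_cons_getLast`)
  have key : ∀ (M : List HV) (hM : M ≠ []) (R : List HV),
      pturn (M ++ toHV zv :: R) = pturn (M ++ [toHV zv]) + pturn (M.getLast hM :: toHV zv :: R) := by
    intro M hM R
    obtain ⟨L₀, l, rfl⟩ : ∃ L₀ l, M = L₀ ++ [l] := ⟨_, _, (List.dropLast_append_getLast hM).symm⟩
    rw [List.getLast_append_singleton, List.append_assoc, List.singleton_append,
      pturn_append_cons_cons, List.append_assoc, List.singleton_append]
  rw [e1, key _ (by simp), List.getLast_map]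
  push_cast
  ring

/-! ### Explicit floor walks -/

/-- Two distinct floor edges are distinct mid-edges. [folklore] -/
theorem floorEdge_ne {ka ke m : ℤ} (h : ka ≠ ke) :
    s(((![ka, m - 1], 1) : HexVertex), ((![ka, m], 0) : HexVertex)) ≠
      s(((![ke, m - 1], 1) : HexVertex), ((![ke, m], 0) : HexVertex)) := by
  rw [Ne, Sym2.eq_iff]
  rintro (⟨h1, -⟩ | ⟨h1, -⟩) <;> simp only [mk_eq_mk_iff] at h1
  · exact h h1.1.1
  · exact absurd h1.2 (by decide)

/-- **The explicit floor walks.** For `ka < ke` on a flat floor there is a walk from the floor edge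
below `(ka,m,0)` to the floor edge below `(ke,m,0)` of winding `-π` (the zigzag `exists_zig`,
turn count `-3`), and a walk back of winding `+π` (its reverse, `pturn_reverse`). [folklore] -/
theorem exists_floor_walks {m k₁ k₂ ka ke : ℤ}
    (hF : ∀ k : ℤ, k₁ ≤ k → k ≤ k₂ → ((![k, m], 0) : HexVertex) ∈ Λ ∧
      ((![k, m - 1], 1) : HexVertex) ∉ Λ ∧ (k < k₂ → ((![k, m], 1) : HexVertex) ∈ Λ))
    (hka₁ : k₁ ≤ ka) (hke₂ : ke ≤ k₂) (hlt : ka < ke) :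
    (∃ Z : HexMidEdgeSAW Λ s(((![ka, m - 1], 1) : HexVertex), ((![ka, m], 0) : HexVertex))
      s(((![ke, m - 1], 1) : HexVertex), ((![ke, m], 0) : HexVertex)), Z.winding = -Real.pi) ∧
    (∃ Z : HexMidEdgeSAW Λ s(((![ke, m - 1], 1) : HexVertex), ((![ke, m], 0) : HexVertex))
      s(((![ka, m - 1], 1) : HexVertex), ((![ka, m], 0) : HexVertex)), Z.winding = Real.pi) := by
  have adjBU : ∀ k : ℤ, hexGraph.Adj ((![k, m - 1], 1) : HexVertex) (![k, m], 0) := fun k => by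
    rw [hexGraph_adj_iff_coord]; simp
  have hBa := (hF ka hka₁ (by omega)).2.1
  have hBe := (hF ke (by omega) hke₂).2.1
  obtain ⟨n, hn⟩ := Int.le.dest (Int.add_one_le_of_lt hlt)
  have e : ka + ((n + 1 : ℕ) : ℤ) = ke := by rw [← hn]; push_cast; ring
  obtain ⟨L, hlast, hnd, hch, -, hsub, -, h3⟩ := exists_zig (Λ := Λ) m (n + 1) ka
    (fun i h1 h2 => (hF i (by omega) (by omega)).1)
    (fun i h1 h2 => (hF i (by omega) (by omega)).2.2 (by omega))
  rw [e] at hlast h3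
  have hsub' : ∀ v ∈ ((![ka, m], 0) : HexVertex) :: L, v ∈ Λ := by
    rintro v (_ | ⟨_, hv⟩)
    · exact (hF ka hka₁ (by omega)).1
    · exact hsub v hv
  have hcode : pturn ((ka, m - 1, true) :: ((((![ka, m], 0) : HexVertex) :: L).map toHV ++
      [(ke, m - 1, true)])) = -3 := by
    simpa only [List.map_cons, toHV_up, List.cons_append] using h3 (Nat.succ_pos n)
  constructor
  · obtain ⟨Z, hZv⟩ := exists_mkWalk (Λ := Λ) s(((![ka, m - 1], 1) : HexVertex), (![ka, m], 0))
      s(((![ke, m - 1], 1) : HexVertex), (![ke, m], 0)) (![ka, m - 1], 1)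
      (((![ka, m], 0) : HexVertex) :: L) (![ke, m - 1], 1) (List.cons_ne_nil _ _) rfl
      (by rw [hlast]) hsub' hnd hch hBa (adjBU ka) hBe (floorEdge_ne hlt.ne)
    have hZlast : ∀ h, Z.verts.getLast h = (![ke, m], 0) := by rw [hZv]; exact fun _ => hlast
    refine ⟨Z, ?_⟩
    rw [winding_eq_pturn_toHV Z rfl hBa (adjBU ka) (adjBU ke) (by rw [hZv]; simp)
      (e := (![ke, m - 1], 1)) (Or.inr ⟨hZlast _, rfl⟩) hBe, hZv]
    simp only [List.map_cons, List.map_append, List.map_nil, toHV_down]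
    rw [← List.map_cons, hcode]
    push_cast
    ring
  · have hL : (((![ka, m], 0) : HexVertex) :: L).reverse ≠ [] := by simp
    have hLhead : (((![ka, m], 0) : HexVertex) :: L).reverse.head hL = (![ke, m], 0) := by
      rw [List.head_reverse, hlast]
    have hLlast : (((![ka, m], 0) : HexVertex) :: L).reverse.getLast hL = (![ka, m], 0) := by
      rw [List.getLast_reverse]; rfl
    obtain ⟨Z, hZv⟩ := exists_mkWalk (Λ := Λ) s(((![ke, m - 1], 1) : HexVertex), (![ke, m], 0))
      s(((![ka, m - 1], 1) : HexVertex), (![ka, m], 0)) (![ke, m - 1], 1)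
      (((![ka, m], 0) : HexVertex) :: L).reverse (![ka, m - 1], 1) hL (by rw [hLhead])
      (by rw [hLlast]) (fun v hv => hsub' v (List.mem_reverse.1 hv)) (List.nodup_reverse.2 hnd)
      (List.isChain_reverse.2 (hch.imp fun a b h => h.symm)) hBe (by rw [hLhead]; exact adjBU ke)
      hBa (floorEdge_ne hlt.ne')
    have hZlast : ∀ h, Z.verts.getLast h = (![ka, m], 0) := by rw [hZv]; exact fun _ => hLlast
    refine ⟨Z, ?_⟩
    rw [winding_eq_pturn_toHV Z rfl hBe (adjBU ke) (adjBU ka) (by rw [hZv]; simp)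
      (e := (![ka, m - 1], 1)) (Or.inr ⟨hZlast _, rfl⟩) hBa, hZv]
    rw [show ((![ke, m - 1], 1) : HexVertex) :: ((((![ka, m], 0) : HexVertex) :: L).reverse ++
        [(![ka, m - 1], 1)]) = (((![ka, m - 1], 1) : HexVertex) :: ((((![ka, m], 0) : HexVertex)
        :: L) ++ [(![ke, m - 1], 1)])).reverse by simp, List.map_reverse, pturn_reverse]
    simp only [List.map_cons, List.map_append, List.map_nil, toHV_down]
    rw [← List.map_cons, hcode]
    push_cast
    ring

/-- **Explicit floor walks, closed form** (the lattice half of clause (E4) of the stub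
`stub_boundaryExactness`): on a flat floor `k₁ ≤ k ≤ k₂` of row `m` and for `ka < ke` on it there
are a walk of winding `-π` from the floor edge below `(ka,m,0)` to the one below `(ke,m,0)` and a
walk of winding `+π` back. [folklore] -/
theorem boundaryExactness_floorWalks :
    ∀ (Λ : Finset HexVertex) (m k₁ k₂ ka ke : ℤ),
      (∀ k : ℤ, k₁ ≤ k → k ≤ k₂ → ((![k, m], 0) : HexVertex) ∈ Λ ∧
        ((![k, m - 1], 1) : HexVertex) ∉ Λ ∧ (k < k₂ → ((![k, m], 1) : HexVertex) ∈ Λ)) →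
      k₁ ≤ ka → ke ≤ k₂ → ka < ke →
      (∃ Z : HexMidEdgeSAW Λ s(((![ka, m - 1], 1) : HexVertex), ((![ka, m], 0) : HexVertex))
        s(((![ke, m - 1], 1) : HexVertex), ((![ke, m], 0) : HexVertex)), Z.winding = -Real.pi) ∧
      (∃ Z : HexMidEdgeSAW Λ s(((![ke, m - 1], 1) : HexVertex), ((![ke, m], 0) : HexVertex))
        s(((![ka, m - 1], 1) : HexVertex), ((![ka, m], 0) : HexVertex)), Z.winding = Real.pi) :=
  fun _ _ _ _ _ _ hF h1 h2 h3 => exists_floor_walks hF h1 h2 h3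

end Summit.CriticalPhenomena.SAWScalingLimit.Theorems.PickHalfPlane.BoundaryExactness
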